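import Summits.AtomisticToContinuum.Crystallization.Theorems.BrittleRungDescentSoftLocalHalesOfHales
import Summits.AtomisticToContinuum.Crystallization.Theorems.BrittleRungDescentSoftLocalHalesOfKernel

/-!
# `SoftLocalHales` is equivalent to Hales's classification of kissing configurations

Helper file for item stmt-AtomisticToContinuum-10944 (`SoftLocalHales`, support of route
`AtomisticToContinuum/Crystallization/BrittleRungDescent`).  The sibling files prove the route's
soft local-Hales statement from the named Literature fact `Hales2012_contactGraphTame` (Hales 2012,
Theorem 3 with Lemma 8; `softLocalHales_of_contactGraphTame`) and from the route's effective kernel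
(`softLocalHales_of_localHalesKernel`).  Here we prove the CONVERSE:

* `contactGraphFccOrHcp_of_softLocalHales : SoftLocalHales → Hales2012_contactGraphFccOrHcp`,

so that `SoftLocalHales ↔ Hales2012_contactGraphFccOrHcp ↔ Hales2012_contactGraphTame`
(`softLocalHales_iff_contactGraphFccOrHcp`, `softLocalHales_iff_contactGraphTame`), and the crux
`LocalHalesKernel` (tolerance `1/400`) also implies Hales's classification
(`contactGraphFccOrHcp_of_localHalesKernel`).

The point is a **padding construction** showing that the second layer of the hypothesis of
`SoftLocalHales` / `LocalHalesKernel` ("every soft neighbour of `u` is itself softly twelve-kissed")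
carries no information: given ANY `V ∈ 𝒱` (twelve points of `S²(2)` with pairwise distances `2` or
`≥ 2h₀ = 2.52`), halve it to twelve unit vectors `A` around `u = 0` and add, on the ray through each
`a ∈ A`, the `11 − deg a` collinear far points `(2 + k η/11) • a`; in the resulting set every point
within `1 + η` of `0` is softly twelve-kissed with tolerance `η` and gap `63/50`, while the soft
neighbourhood of `0` is exactly `A` with soft contact = exact contact.  Hence any proof of the
item (or of the crux `LocalHalesKernel`) contains a proof of the graph form of Hales's Theorem 3 +
Lemma 9 for the whole class `𝒱`; there is no shortcut through the two-layer hypothesis.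
-/

noncomputable section

namespace Summit.AtomisticToContinuum.Crystallization.Theorems

open Literature.Geometry.DiscreteGeometry
open Summit.AtomisticToContinuum.Crystallization.Theses.BrittleRungDescent

/-! ### Step 1. Elementary metric facts about unit vectors -/

/-- For unit vectors `a, a'` at distance `≥ 1`, the point `2 • a` is at distance `≥ 3/2` from `a'`
(indeed `‖a' − 2a‖² = 5 − 4⟪a', a⟫ ≥ 3`). [folklore] -/
theorem three_halves_le_dist_two_smul {a a' : EuclideanSpace ℝ (Fin 3)} (ha : ‖a‖ = 1)
    (ha' : ‖a'‖ = 1) (h : 1 ≤ dist a' a) : 3 / 2 ≤ dist a' ((2 : ℝ) • a) := by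
  have h1 : dist a' a ^ 2 = 2 - 2 * inner ℝ a' a := by
    rw [dist_eq_norm, norm_sub_sq_real, ha, ha']; ring
  have h2 : dist a' ((2 : ℝ) • a) ^ 2 = 5 - 4 * inner ℝ a' a := by
    rw [dist_eq_norm, norm_sub_sq_real, inner_smul_right, norm_smul,
      Real.norm_of_nonneg zero_le_two, ha, ha']
    ring
  have h3 : 1 ≤ dist a' a ^ 2 := by nlinarith [dist_nonneg (x := a') (y := a)]
  have h4 : (3 / 2 : ℝ) ^ 2 ≤ dist a' ((2 : ℝ) • a) ^ 2 := by nlinarith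
  nlinarith [dist_nonneg (x := a') (y := (2:ℝ) • a)]


/-- Norm of a point of the ray through a unit vector: `‖(2 + t) • a‖ = 2 + t` for `t ≥ 0`.
[folklore] -/
theorem norm_ray_smul {a : EuclideanSpace ℝ (Fin 3)} (ha : ‖a‖ = 1) {t : ℝ} (ht : 0 ≤ t) :
    ‖((2 : ℝ) + t) • a‖ = 2 + t := by
  rw [norm_smul, ha, mul_one, Real.norm_of_nonneg (by linarith)]

/-- Distance from the unit vector `a` to the ray point `(2 + t) • a` is `1 + t`. [folklore] -/
theorem dist_ray_smul_self {a : EuclideanSpace ℝ (Fin 3)} (ha : ‖a‖ = 1) {t : ℝ} (ht : 0 ≤ t) :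
    dist a (((2 : ℝ) + t) • a) = 1 + t := by
  have : a - ((2 : ℝ) + t) • a = ((1 : ℝ) - (2 + t)) • a := by rw [sub_smul, one_smul]
  rw [dist_eq_norm, this, norm_smul, ha, mul_one, show (1 : ℝ) - (2 + t) = -(1 + t) by ring,
    norm_neg, Real.norm_of_nonneg (by linarith)]

/-- Distance from another unit vector `a'` (at distance `≥ 1` from `a`) to the ray point
`(2 + t) • a` is `≥ 3/2 − t`. [folklore] -/
theorem dist_ray_smul_other {a a' : EuclideanSpace ℝ (Fin 3)} (ha : ‖a‖ = 1) (ha' : ‖a'‖ = 1)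
    (h : 1 ≤ dist a' a) {t : ℝ} (ht : 0 ≤ t) : 3 / 2 - t ≤ dist a' (((2 : ℝ) + t) • a) := by
  have h1 := three_halves_le_dist_two_smul ha ha' h
  have h2 : dist (((2 : ℝ) + t) • a) ((2 : ℝ) • a) = t := by
    rw [dist_eq_norm, ← sub_smul, add_sub_cancel_left, norm_smul, ha, mul_one,
      Real.norm_of_nonneg ht]
  have h3 := dist_triangle a' (((2 : ℝ) + t) • a) ((2 : ℝ) • a)
  linarith


/-! ### Step 2. The padding construction -/

/-- **Padding: every twelve-point unit configuration with the gap extends to a two-layer soft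
configuration.**  Let `A` be twelve unit vectors with pairwise distances `= 1` or `≥ 63/50`, and
`0 < η ≤ 1/10`.  Adding the origin and, on the ray through each `a ∈ A`, the `11 − deg a` points
`(2 + k η/11) • a` (`k < 11 − deg a`, `deg a` = number of soft contacts of `a` in `A`), we obtain a
set `S ∋ 0` in which every point within `1 + η` of `0` is softly twelve-kissed with tolerance `η`
and gap `63/50` (the hypothesis of `SoftLocalHales` / `LocalHalesKernel` at `u = 0`), and whose
soft neighbourhood of `0` is exactly `A`. [folklore] -/
theorem exists_soft_extension (A : Set (EuclideanSpace ℝ (Fin 3))) (hA : A.ncard = 12)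
    (hAn : ∀ a ∈ A, ‖a‖ = 1)
    (hAgap : ∀ a ∈ A, ∀ a' ∈ A, a ≠ a' → dist a a' = 1 ∨ 63 / 50 ≤ dist a a')
    {η : ℝ} (hη : 0 < η) (hη' : η ≤ 1 / 10) :
    ∃ S : Set (EuclideanSpace ℝ (Fin 3)), (0 : EuclideanSpace ℝ (Fin 3)) ∈ S ∧
      (∀ v ∈ S, dist 0 v ≤ 1 + η →
        ((∀ w ∈ S, w ≠ v → 1 - η ≤ dist v w ∧ (dist v w ≤ 1 + η ∨ 63 / 50 ≤ dist v w)) ∧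
          {w ∈ S | w ≠ v ∧ dist v w ≤ 1 + η}.ncard = 12)) ∧
      (∀ w : EuclideanSpace ℝ (Fin 3), (w ∈ S ∧ w ≠ 0 ∧ dist 0 w ≤ 1 + η) ↔ w ∈ A) := by
  classical
  have hAfin : A.Finite := Set.finite_of_ncard_ne_zero (by rw [hA]; norm_num)
  set δ : ℝ := η / 11 with hδ
  have hδpos : 0 < δ := by positivity
  -- soft contact degree inside `A`
  set d : EuclideanSpace ℝ (Fin 3) → ℕ :=
    fun a => {a' ∈ A | a' ≠ a ∧ dist a a' ≤ 1 + η}.ncard with hd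
  -- the far points on the ray through `a`
  set B : EuclideanSpace ℝ (Fin 3) → Set (EuclideanSpace ℝ (Fin 3)) := fun a =>
    (fun k : ℕ => ((2 : ℝ) + (k : ℝ) * δ) • a) '' Set.Iio (11 - d a) with hB
  set S : Set (EuclideanSpace ℝ (Fin 3)) := insert 0 (A ∪ ⋃ a ∈ A, B a) with hS
  -- membership
  have hA0 : (0 : EuclideanSpace ℝ (Fin 3)) ∉ A := fun h => by simpa using hAn 0 h
  have hmemS : ∀ w, w ∈ S ↔ w = 0 ∨ w ∈ A ∨ ∃ a ∈ A, w ∈ B a := by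
    intro w
    simp only [hS, Set.mem_insert_iff, Set.mem_union, Set.mem_iUnion, exists_prop]
  have hmemB : ∀ a w, w ∈ B a ↔ ∃ k : ℕ, k < 11 - d a ∧ ((2 : ℝ) + (k : ℝ) * δ) • a = w := by
    intro a w
    simp only [hB, Set.mem_image, Set.mem_Iio]
  have hkδ : ∀ (a : EuclideanSpace ℝ (Fin 3)) (k : ℕ), k < 11 - d a →
      0 ≤ (k : ℝ) * δ ∧ (k : ℝ) * δ < η := by
    intro a k hk
    have hk10 : (k : ℝ) ≤ 10 := by exact_mod_cast (by omega : k ≤ 10)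
    refine ⟨by positivity, ?_⟩
    rw [hδ]
    nlinarith
  have h0S : (0 : EuclideanSpace ℝ (Fin 3)) ∈ S := (hmemS 0).2 (Or.inl rfl)
  have hAS : ∀ a ∈ A, a ∈ S := fun a ha => (hmemS a).2 (Or.inr (Or.inl ha))
  have hBS : ∀ a ∈ A, ∀ w ∈ B a, w ∈ S := fun a ha w hw => (hmemS w).2 (Or.inr (Or.inr ⟨a, ha, hw⟩))
  -- norms
  have hnormB : ∀ a ∈ A, ∀ w ∈ B a, 2 ≤ ‖w‖ := by
    intro a ha w hw
    obtain ⟨k, hk, rfl⟩ := (hmemB a w).1 hw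
    rw [norm_ray_smul (hAn a ha) (hkδ a k hk).1]
    linarith [(hkδ a k hk).1]
  -- distances from `a ∈ A` to the far points
  have hdistBself : ∀ a ∈ A, ∀ w ∈ B a, 1 ≤ dist a w ∧ dist a w < 1 + η := by
    intro a ha w hw
    obtain ⟨k, hk, rfl⟩ := (hmemB a w).1 hw
    rw [dist_ray_smul_self (hAn a ha) (hkδ a k hk).1]
    constructor <;> linarith [(hkδ a k hk).1, (hkδ a k hk).2]
  have hdistBother : ∀ a ∈ A, ∀ a' ∈ A, a' ≠ a → ∀ w ∈ B a, 3 / 2 - η ≤ dist a' w := by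
    intro a ha a' ha' hne w hw
    obtain ⟨k, hk, rfl⟩ := (hmemB a w).1 hw
    have h1 : 1 ≤ dist a' a := by rcases hAgap a' ha' a ha hne with h | h <;> linarith
    have := dist_ray_smul_other (hAn a ha) (hAn a' ha') h1 (hkδ a k hk).1
    linarith [(hkδ a k hk).2]
  -- the soft neighbourhood of `0` is `A`
  have hnbr : ∀ w : EuclideanSpace ℝ (Fin 3), (w ∈ S ∧ w ≠ 0 ∧ dist 0 w ≤ 1 + η) ↔ w ∈ A := by
    intro w
    constructor
    · rintro ⟨hw, hw0, hwd⟩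
      rcases (hmemS w).1 hw with h | h | ⟨a, ha, h⟩
      · exact absurd h hw0
      · exact h
      · exfalso; have := hnormB a ha w h; rw [dist_zero_left] at hwd; linarith
    · intro hw
      refine ⟨hAS w hw, fun h => hA0 (h ▸ hw), ?_⟩
      rw [dist_zero_left, hAn w hw]
      linarith
  refine ⟨S, h0S, ?_, hnbr⟩
  intro v hv hvd
  -- `v` is `0` or a point of `A`
  have hv' : v = 0 ∨ v ∈ A := by
    rcases (hmemS v).1 hv with h | h | ⟨a, ha, h⟩
    · exact Or.inl h
    · exact Or.inr h
    · exfalso; have := hnormB a ha v h; rw [dist_zero_left] at hvd; linarith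
  rcases hv' with rfl | hvA
  · -- the centre
    refine ⟨fun w hw hw0 => ?_, ?_⟩
    · rcases (hmemS w).1 hw with h | h | ⟨a, ha, h⟩
      · exact absurd h hw0
      · rw [dist_zero_left, hAn w h]
        exact ⟨by linarith, Or.inl (by linarith)⟩
      · have := hnormB a ha w h
        rw [dist_zero_left]; exact ⟨by linarith, Or.inr (by linarith)⟩
    · have : {w ∈ S | w ≠ 0 ∧ dist 0 w ≤ 1 + η} = A := Set.ext fun w => hnbr w
      rw [this, hA]
  · -- a point `a = v` of `A`
    have hva : ‖v‖ = 1 := hAn v hvA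
    refine ⟨fun w hw hwv => ?_, ?_⟩
    · rcases (hmemS w).1 hw with h | h | ⟨a, ha, h⟩
      · subst h
        rw [dist_zero_right, hva]
        exact ⟨by linarith, Or.inl (by linarith)⟩
      · rcases hAgap v hvA w h (Ne.symm hwv) with h' | h'
        · rw [h']
          exact ⟨by linarith, Or.inl (by linarith)⟩
        · exact ⟨by linarith, Or.inr h'⟩
      · by_cases hav : a = v
        · subst hav
          have := hdistBself a ha w h
          exact ⟨by linarith [this.1], Or.inl this.2.le⟩
        · have := hdistBother a ha v hvA (Ne.symm hav) w h
          exact ⟨by linarith, Or.inr (by linarith)⟩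
    · -- the soft neighbourhood of `v`: the centre, the soft contacts in `A`, and the far points
      set M : Set (EuclideanSpace ℝ (Fin 3)) := {a' ∈ A | a' ≠ v ∧ dist v a' ≤ 1 + η} with hM
      have hMfin : M.Finite := hAfin.subset fun x hx => hx.1
      have hBfin : (B v).Finite := (Set.finite_Iio _).image _
      have hset : {w ∈ S | w ≠ v ∧ dist v w ≤ 1 + η} = insert 0 (M ∪ B v) := by
        ext w
        simp only [Set.mem_setOf_eq, Set.mem_insert_iff, Set.mem_union]
        constructor
        · rintro ⟨hw, hwv, hwd⟩
          rcases (hmemS w).1 hw with h | h | ⟨a, ha, h⟩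
          · exact Or.inl h
          · exact Or.inr (Or.inl ⟨h, hwv, hwd⟩)
          · by_cases hav : a = v
            · subst hav
              exact Or.inr (Or.inr h)
            · exfalso; have := hdistBother a ha v hvA (Ne.symm hav) w h; linarith
        · rintro (h | h | h)
          · subst h
            refine ⟨h0S, fun h => hA0 (h ▸ hvA), ?_⟩
            rw [dist_zero_right, hva]
            linarith
          · exact ⟨hAS w h.1, h.2.1, h.2.2⟩
          · refine ⟨hBS v hvA w h, fun h' => ?_, (hdistBself v hvA w h).2.le⟩
            have := hnormB v hvA w h; rw [h', hva] at this; linarith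
      have h0MB : (0 : EuclideanSpace ℝ (Fin 3)) ∉ M ∪ B v := by
        rintro (h | h)
        · exact hA0 h.1
        · have := hnormB v hvA 0 h; rw [norm_zero] at this; linarith
      have hdisj : Disjoint M (B v) := by
        rw [Set.disjoint_left]
        intro w hwM hwB; have h1 := hAn w hwM.1; have h2 := hnormB v hvA w hwB; linarith
      -- `|B v| = 11 - d v`
      have hv0 : v ≠ 0 := fun h => hA0 (h ▸ hvA)
      have hinj : Function.Injective (fun k : ℕ => ((2 : ℝ) + (k : ℝ) * δ) • v) := by
        intro k k' hkk'
        have h1 : (2 : ℝ) + (k : ℝ) * δ = 2 + (k' : ℝ) * δ := smul_left_injective ℝ hv0 hkk'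
        exact_mod_cast
          (mul_right_cancel₀ hδpos.ne' (by linarith : (k : ℝ) * δ = k' * δ) : (k : ℝ) = k')
      have hBcard : (B v).ncard = 11 - d v := by
        rw [hB]; simp only
        rw [Set.ncard_image_of_injective _ hinj, ← Finset.coe_range, Set.ncard_coe_finset,
          Finset.card_range]
      -- `d v ≤ 11`
      have hdle : d v ≤ 11 := by
        have hsub : M ⊆ A \ {v} := fun x hx => ⟨hx.1, fun h => hx.2.1 h⟩
        have h1 := Set.ncard_le_ncard hsub hAfin.sdiff
        rwa [Set.ncard_sdiff_singleton_of_mem hvA, hA] at h1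
      rw [hset, Set.ncard_insert_of_notMem h0MB (hMfin.union hBfin),
        Set.ncard_union_eq hdisj hMfin hBfin, hBcard]
      show d v + (11 - d v) + 1 = 12
      omega


/-! ### Step 3. From the soft statement back to Hales's classification -/

/-- The pattern side: `{p // p ∈ P} ≃ ↥(2 • P)` with `κ q = 2 • q`. [folklore] -/
theorem exists_equiv_two_smul_pattern (P : Finset (EuclideanSpace ℝ (Fin 3))) :
    ∃ κ : {p : EuclideanSpace ℝ (Fin 3) // p ∈ P} ≃
        ((fun p : EuclideanSpace ℝ (Fin 3) => (2 : ℝ) • p) '' (P : Set (EuclideanSpace ℝ (Fin 3)))),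
      ∀ q, (κ q).1 = (2 : ℝ) • q.1 := by
  have hinj : Function.Injective (fun p : EuclideanSpace ℝ (Fin 3) => (2 : ℝ) • p) :=
    smul_right_injective (EuclideanSpace ℝ (Fin 3)) (two_ne_zero (α := ℝ))
  exact ⟨(Equiv.subtypeEquivRight (fun _ => Finset.mem_coe.symm)).trans (Equiv.Set.image _ _ hinj),
    fun q => rfl⟩

/-- **`SoftLocalHales` implies Hales's classification of the contact graphs of kissing
configurations** (`Hales2012_contactGraphFccOrHcp`, the graph form of Hales 2012, Theorem 3 with
Lemma 9): halve `V ∈ 𝒱`, pad it to a two-layer soft configuration (`exists_soft_extension`), apply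
the soft statement at `u = 0` with `η = min η₀ (1/10)`, and read the bijection off as a graph
isomorphism (below the gap, soft contact at tolerance `η` is exact contact). [folklore] -/
theorem contactGraphFccOrHcp_of_softLocalHales (h : SoftLocalHales) :
    Hales2012_contactGraphFccOrHcp := by
  classical
  obtain ⟨η₀, hη₀, h⟩ := h
  intro T hT
  set η : ℝ := min η₀ (1 / 10) with hη
  have hηpos : 0 < η := lt_min hη₀ (by norm_num)
  have hηle : η ≤ η₀ := min_le_left _ _
  have hη10 : η ≤ 1 / 10 := min_le_right _ _
  -- halve the configuration
  have hinj2 : Function.Injective (fun x : EuclideanSpace ℝ (Fin 3) => (1 / 2 : ℝ) • x) :=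
    smul_right_injective (EuclideanSpace ℝ (Fin 3)) (by norm_num : (1 / 2 : ℝ) ≠ 0)
  set A : Set (EuclideanSpace ℝ (Fin 3)) :=
    (fun x : EuclideanSpace ℝ (Fin 3) => (1 / 2 : ℝ) • x) '' T with hAdef
  have hA : A.ncard = 12 := by rw [hAdef, Set.ncard_image_of_injective _ hinj2, hT.ncard_eq]
  have hmemA : ∀ a, a ∈ A ↔ (2 : ℝ) • a ∈ T := by
    intro a
    rw [hAdef, Set.mem_image]
    constructor
    · rintro ⟨x, hx, rfl⟩
      rw [smul_smul, show (2 : ℝ) * (1 / 2) = 1 by norm_num, one_smul]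
      exact hx
    · intro h
      exact ⟨(2 : ℝ) • a, h, by rw [smul_smul, show (1 / 2 : ℝ) * 2 = 1 by norm_num, one_smul]⟩
  have hdistA : ∀ a a' : EuclideanSpace ℝ (Fin 3),
      dist ((2 : ℝ) • a) ((2 : ℝ) • a') = 2 * dist a a' := by
    intro a a'
    rw [dist_smul₀, Real.norm_of_nonneg zero_le_two]
  have hAn : ∀ a ∈ A, ‖a‖ = 1 := by
    intro a ha
    have := hT.norm_eq ((hmemA a).1 ha)
    rw [norm_smul, Real.norm_of_nonneg zero_le_two] at this
    linarith
  have hAgap : ∀ a ∈ A, ∀ a' ∈ A, a ≠ a' → dist a a' = 1 ∨ 63 / 50 ≤ dist a a' := by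
    intro a ha a' ha' hne
    have hne2 : (2 : ℝ) • a ≠ (2 : ℝ) • a' := fun h =>
      hne (smul_right_injective (EuclideanSpace ℝ (Fin 3)) (two_ne_zero (α := ℝ)) h)
    rcases hT.2.2 _ ((hmemA a).1 ha) _ ((hmemA a').1 ha') with h | h | h
    · exact absurd h hne2
    · left; rw [hdistA] at h; linarith
    · right; rw [hdistA, hales_h0_eq] at h; norm_num at h ⊢; linarith
  -- pad, and apply the soft statement at `u = 0`
  obtain ⟨S, h0S, hyp, hnbr⟩ := exists_soft_extension A hA hAn hAgap hηpos hη10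
  have concl := h η hηpos hηle S 0 h0S hyp
  -- the soft neighbourhood of `0` is `T` halved
  set ι : ↥T ≃ {w : EuclideanSpace ℝ (Fin 3) // w ∈ S ∧ w ≠ 0 ∧ dist 0 w ≤ 1 + η} :=
    (Equiv.Set.image _ T hinj2).trans (Equiv.subtypeEquivRight fun w => (hnbr w).symm) with hι
  have hι1 : ∀ x : ↥T, (ι x).1 = (1 / 2 : ℝ) • x.1 := fun x => rfl
  -- below the gap, soft contact of the halved points is contact in `T`
  have hadj : ∀ x y : ↥T, x ≠ y → (dist (ι x).1 (ι y).1 ≤ 1 + η ↔ dist x.1 y.1 = 2) := by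
    intro x y hxy
    rw [hι1, hι1, dist_smul₀, Real.norm_of_nonneg (by norm_num : (0 : ℝ) ≤ 1 / 2)]
    have hne : x.1 ≠ y.1 := fun h => hxy (Subtype.ext h)
    rcases hT.2.2 _ x.2 _ y.2 with h | h | h
    · exact absurd h hne
    · rw [h]
      exact ⟨fun _ => rfl, fun _ => by linarith⟩
    · rw [hales_h0_eq] at h
      norm_num at h
      exact ⟨fun h' => by exfalso; linarith, fun h' => by rw [h'] at h; norm_num at h⟩
  -- transport along the bijection given by the soft statement
  have transport : ∀ P : Finset (EuclideanSpace ℝ (Fin 3)),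
      (∃ e : {w : EuclideanSpace ℝ (Fin 3) // w ∈ S ∧ w ≠ 0 ∧ dist 0 w ≤ 1 + η} ≃
          {q : EuclideanSpace ℝ (Fin 3) // q ∈ P},
        ∀ w w' : {w : EuclideanSpace ℝ (Fin 3) // w ∈ S ∧ w ≠ 0 ∧ dist 0 w ≤ 1 + η}, w ≠ w' →
          (dist w.1 w'.1 ≤ 1 + η ↔ dist (e w).1 (e w').1 = 1)) →
      Nonempty (contactGraph T ≃g
        contactGraph ((fun p : EuclideanSpace ℝ (Fin 3) => (2 : ℝ) • p) ''
          (P : Set (EuclideanSpace ℝ (Fin 3))))) := by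
    rintro P ⟨e, he⟩
    obtain ⟨κ, hκ⟩ := exists_equiv_two_smul_pattern P
    refine ⟨⟨(ι.trans e).trans κ, ?_⟩⟩
    intro x y
    simp only [contactGraph_adj, Equiv.trans_apply]
    rw [hκ, hκ, hdistA]
    by_cases hxy : x = y
    · subst hxy
      simp
    · have hne : ι x ≠ ι y := fun h => hxy (ι.injective h)
      rw [← hadj x y hxy, he _ _ hne]
      exact ⟨fun h => by linarith, fun h => by rw [h]; norm_num⟩
  rcases concl with h | h
  · exact Or.inl (transport _ h)
  · exact Or.inr (transport _ h)


/-! ### Step 4. The equivalences -/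

/-- **`SoftLocalHales ↔ Hales2012_contactGraphFccOrHcp`.**  The route's (unconditionally stated)
soft local-Hales support item is equivalent to the graph form of Hales 2012, Theorem 3 with
Lemma 9 (the contact graph of every `V ∈ 𝒱` is the FCC or the HCP contact graph).
[cite: Hales2012, Theorem 3 and Lemma 9] -/
theorem softLocalHales_iff_contactGraphFccOrHcp :
    SoftLocalHales ↔ Hales2012_contactGraphFccOrHcp :=
  ⟨contactGraphFccOrHcp_of_softLocalHales, softLocalHales_of_contactGraphFccOrHcp⟩

/-- The FCC/HCP classification implies the tame classification (graphs `1` and `0` of Lemma 8's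
list are the FCC and HCP contact graphs, `contactGraphTame_fcc_hcp`). [cite: Hales2012, Lemma 8] -/
theorem contactGraphTame_of_contactGraphFccOrHcp (h : Hales2012_contactGraphFccOrHcp) :
    Hales2012_contactGraphTame := by
  intro S hS
  rcases h S hS with ⟨⟨φ⟩⟩ | ⟨⟨φ⟩⟩
  · obtain ⟨i, ⟨ψ⟩⟩ := contactGraphTame_fcc_hcp.1
    exact ⟨i, ⟨φ.trans ψ⟩⟩
  · obtain ⟨i, ⟨ψ⟩⟩ := contactGraphTame_fcc_hcp.2
    exact ⟨i, ⟨φ.trans ψ⟩⟩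

/-- **`SoftLocalHales ↔ Hales2012_contactGraphTame`.**  With Lemma 9 proved in the tree
(`contactGraphFccOrHcp_of_contactGraphTame`), the item is equivalent to the one remaining
computer-assisted named fact of Hales's proof of Fejes Tóth's conjecture, Theorem 3 with Lemma 8
in graph form: an unconditional proof of the item IS a proof of that fact.
[cite: Hales2012, Theorem 3 and Lemma 8] -/
theorem softLocalHales_iff_contactGraphTame : SoftLocalHales ↔ Hales2012_contactGraphTame :=
  ⟨fun h => contactGraphTame_of_contactGraphFccOrHcp (contactGraphFccOrHcp_of_softLocalHales h),
    softLocalHales_of_contactGraphTame⟩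

/-- **The crux `LocalHalesKernel` (tolerance `1/400`) implies Hales's classification** of the
contact graphs of all `V ∈ 𝒱`: any proof of the effective kernel contains a proof of the graph
form of Hales 2012, Theorem 3 with Lemma 9. [cite: Hales2012, Theorem 3 and Lemma 9] -/
theorem contactGraphFccOrHcp_of_localHalesKernel (hK : LocalHalesKernel) :
    Hales2012_contactGraphFccOrHcp :=
  contactGraphFccOrHcp_of_softLocalHales (softLocalHales_of_localHalesKernel hK)

/-- Hence `SoftLocalHales` also gives the congruence classification of kissing configurations
(Hales 2012, Lemmas 9–10: every `V ∈ 𝒱` is congruent to the FCC or HCP configuration), Lemma 10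
being proved in the tree (`kissingConfigCongruent_of_contactGraphFccOrHcp`).
[cite: Hales2012, Lemma 10] -/
theorem kissingConfigCongruent_of_softLocalHales (h : SoftLocalHales) :
    Hales2012_kissingConfigCongruent :=
  kissingConfigCongruent_of_contactGraphFccOrHcp (contactGraphFccOrHcp_of_softLocalHales h)

end Summit.AtomisticToContinuum.Crystallization.Theorems

end
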